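import Literature.Geometry.Riemannian.GurskyEinsteinGap
import Literature.Geometry.Riemannian.SphericalSpaceFormOfConstantCurvature
import HarnessLib

/-!
# Gursky's Einstein gap on homotopy 4-spheres with Killing–Hopf recognition
# (the `M ≅ S⁴` alternative without Hamilton's PIC theorem)

`GurskyEinsteinGap.lean` upgrades the first alternative of the named fact
`gursky_einstein_homotopySphere_four` (Gursky 2000, Thm. 1 / Gursky–LeBrun 1999, Thm. 1 and
Cor. 1 on `M ≃ₕ S⁴`: an Einstein metric `Ric = λ g`, `λ > 0`, has `W ≡ 0` or `vol ≤ 8π²/λ²`)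
to constant sectional curvature `λ/3` (`….hasConstantSectionalCurvature_or_volume_le`, via
Besse 1987, 1.118, PROVED in `EinsteinWeylZero.lean`) and then to `M ≅ S⁴`
(`….diffeomorph_sphere_or_volume_le`) USING the named fact `hamilton_pic_sphere_four`
(Hamilton 1997), remarking that "any recognition theorem for compact simply connected manifolds
of constant positive curvature (Killing–Hopf) serves equally". That recognition theorem IS
proved in the tree: the Killing–Hopf theorem in quotient form
(`KillingHopf.exists_orthogonal_quotient`, `isSphericalSpaceForm_of_constantCurvature`; Lee 2018,
Thm. 12.4 with Cor. 12.5) and "a simply connected spherical space form is diffeomorphic to `𝕊ⁿ`"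
(`IsSphericalSpaceForm.nonempty_diffeomorph_sphere_of_simplyConnectedSpace`; Hatcher, Prop. 1.40).
This file composes them, removing Hamilton's theorem from the trust base of the sphere
alternative (everything below is PROVED; no definition, no named fact):

* `nonempty_diffeomorph_sphere_four_of_hasConstantSectionalCurvature` — **Killing–Hopf, simply
  connected compact case, dimension 4**: a compact simply connected smooth 4-manifold carrying a
  Riemannian metric of constant sectional curvature `c > 0` is diffeomorphic to `S⁴`;
* `gursky_einstein_homotopySphere_four.diffeomorph_sphere_or_volume_le_killingHopf` — under the
  fact, an Einstein metric `Ric = λ g`, `λ > 0`, on a closed smooth `M ≃ₕ S⁴` gives `M ≅ S⁴` or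
  `vol(M, g) ≤ 8π²/λ²`;
* `gursky_einstein_homotopySphere_four.diffeomorph_sphere_of_ricci_eq_three` — the case `λ = 3`
  with the strict volume bound `Vol(M, h) > 8π²/9` for a `Bundle.ContMDiffRiemannianMetric` `h`:
  `M ≅ S⁴`. This is, verbatim, the "KNOWN half" `stub_einsteinWeylGap` of the line `birth` of crux
  `RecognitionBeyondWeylGap` (route SmoothPoincare4/RicciFat, stmt-SmoothPoincare4-18049; ledger
  cite item wi-39228, which asked for (i) "conformally flat Einstein ⇒ constant curvature" =
  `hasConstantSectionalCurvature_of_ricci_eq_of_weylFrame_eq_zero` and (ii) Killing–Hopf = the two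
  theorems above — both already proved, so no fact is vendored), now conditional ONLY on
  `gursky_einstein_homotopySphere_four` (itself proved from three printed children,
  `gursky_einstein_homotopySphere_four_holds_of_three`, `GurskyEinsteinGapSplitThree.lean`).

## References

* J. M. Lee, *Introduction to Riemannian Manifolds*, 2nd ed. (2018), Thm. 12.4 (Killing–Hopf),
  Cor. 12.5. [Lee2018]
* M. J. Gursky, Math. Ann. 318 (2000) 417–431, Thm. 1. [Gursky2000]
* M. J. Gursky, C. LeBrun, Ann. Global Anal. Geom. 17 (1999) 315–328, Thm. 1, Cor. 1.
  [GurskyLeBrun1999]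
* A. L. Besse, *Einstein Manifolds* (1987), 1.118. [Besse1987]
* A. Hatcher, *Algebraic Topology* (2002), Prop. 1.40. [HatcherAT2002]
-/

noncomputable section

open scoped Manifold ContDiff ENNReal ContinuousMap

namespace Literature.Geometry.Riemannian

open Literature.Geometry.Lorentzian (PseudoRiemannianMetric riemannianMeasure)
open Literature.Geometry.Lorentzian.PseudoRiemannianMetric

/-- **Killing–Hopf recognition of `S⁴`** (Lee 2018, Thm. 12.4: "a complete, simply connected
Riemannian `n`-manifold with constant sectional curvature `c > 0` is isometric to the round
sphere of radius `1/√c`"; here the diffeomorphism statement in dimension `4`): a compact,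
Hausdorff, simply connected `C^∞` 4-manifold modelled on `ℝ⁴` carrying a Riemannian
`PseudoRiemannianMetric` of constant sectional curvature `c > 0` (for every Levi-Civita
connection, `HasConstantSectionalCurvature`) is `C^∞`-diffeomorphic to the unit sphere
`S⁴ ⊂ ℝ⁵`. Proof: `M` is a spherical space form `𝕊⁴/Γ`
(`isSphericalSpaceForm_of_constantCurvature`, the tree's Killing–Hopf theorem in quotient form),
and a simply connected spherical space form is diffeomorphic to `𝕊⁴`
(`IsSphericalSpaceForm.nonempty_diffeomorph_sphere_of_simplyConnectedSpace`).
[cite: Lee2018, Thm. 12.4 and Cor. 12.5] -/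
theorem nonempty_diffeomorph_sphere_four_of_hasConstantSectionalCurvature
    (M : Type*) [TopologicalSpace M] [T2Space M] [CompactSpace M] [SimplyConnectedSpace M]
    [ChartedSpace (EuclideanSpace ℝ (Fin 4)) M] [IsManifold (𝓡 4) ∞ M] {c : ℝ} (hc : 0 < c)
    (g : PseudoRiemannianMetric (𝓡 4) ∞ (EuclideanSpace ℝ (Fin 4))
      (TangentSpace (𝓡 4) : M → Type _))
    (hg : g.IsRiemannian) (hK : g.HasConstantSectionalCurvature c) :
    Nonempty (M ≃ₘ⟮𝓡 4, 𝓡 4⟯ Metric.sphere (0 : EuclideanSpace ℝ (Fin 5)) 1) :=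
  (isSphericalSpaceForm_of_constantCurvature (by norm_num) M hc g hg
    hK).nonempty_diffeomorph_sphere_of_simplyConnectedSpace (by norm_num) inferInstance

namespace gursky_einstein_homotopySphere_four

variable (M : Type) [TopologicalSpace M] [T2Space M] [SecondCountableTopology M]
  [ChartedSpace (EuclideanSpace ℝ (Fin 4)) M] [IsManifold (𝓡 4) ∞ M] [CompactSpace M]
  [T3Space M] [MeasurableSpace M] [BorelSpace M]

/-- **Gursky's gap with Killing–Hopf: `M ≅ S⁴` or `vol ≤ 8π²/λ²`**, for an Einstein metric
`Ric = λ g`, `λ > 0`, on a closed smooth `M ≃ₕ S⁴`, under the fact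
`gursky_einstein_homotopySphere_four`. As `diffeomorph_sphere_or_volume_le`
(`GurskyEinsteinGap.lean`) but with the sphere recognised by the PROVED Killing–Hopf theorem
(`nonempty_diffeomorph_sphere_four_of_hasConstantSectionalCurvature`, at `c = λ/3 > 0`;
`M ≃ₕ S⁴` is simply connected) instead of Hamilton's PIC theorem.
[cite: Gursky2000, Thm. 1] [cite: Lee2018, Thm. 12.4] [cite: Besse1987, 1.118] -/
theorem diffeomorph_sphere_or_volume_le_killingHopf (h : gursky_einstein_homotopySphere_four)
    (e : M ≃ₕ Metric.sphere (0 : EuclideanSpace ℝ (Fin 5)) 1)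
    (g : PseudoRiemannianMetric (𝓡 4) ∞ (EuclideanSpace ℝ (Fin 4))
      (TangentSpace (𝓡 4) : M → Type _))
    [g.HasLeviCivita] (hg : g.IsRiemannian) {lam : ℝ} (hlam : 0 < lam)
    (hRic : ∀ (x : M) (X Y : TangentSpace (𝓡 4) x), g.ricci x X Y = lam * g.val x X Y) :
    Nonempty (M ≃ₘ⟮𝓡 4, 𝓡 4⟯ Metric.sphere (0 : EuclideanSpace ℝ (Fin 5)) 1) ∨
      riemannianMeasure (g.toContMDiffRiemannianMetric hg) Set.univ ≤
        ENNReal.ofReal (8 * Real.pi ^ 2 / lam ^ 2) := by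
  rcases hasConstantSectionalCurvature_or_volume_le M g h e hg hlam hRic with hK | hvol
  · left
    haveI : SimplyConnectedSpace (Metric.sphere (0 : EuclideanSpace ℝ (Fin (4 + 1))) 1) :=
      Literature.AlgebraicTopology.FundamentalGroup.simplyConnectedSpace_euclideanSphere 4
        (by norm_num)
    haveI : SimplyConnectedSpace M := e.simplyConnectedSpace_iff.2 inferInstance
    exact nonempty_diffeomorph_sphere_four_of_hasConstantSectionalCurvature M (by positivity) g
      hg hK
  · exact Or.inr hvol

/-- **The case `Ric = 3h`, `Vol > 8π²/9` (the "known half" of crux `RecognitionBeyondWeylGap`,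
route SmoothPoincare4/RicciFat, in its binder shape):** under `gursky_einstein_homotopySphere_four`,
a closed smooth `M ≃ₕ S⁴` carrying a `C^∞` Riemannian metric `h` (a
`Bundle.ContMDiffRiemannianMetric`, with the Levi-Civita connection of `ofRiemannian h`) with
`Ric_h = 3h` and `Vol(M, h) = riemannianMeasure h univ > 8π²/9 = 8π²/3²` is diffeomorphic to
`S⁴`: the volume alternative of `diffeomorph_sphere_or_volume_le_killingHopf` at `λ = 3` is
excluded (`(ofRiemannian h).toContMDiffRiemannianMetric _ = h` by `rfl`; `M` is `T₃`, being
compact Hausdorff). [cite: Gursky2000, Thm. 1] [cite: GurskyLeBrun1999, Thm. 1 and Cor. 1]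
[cite: Lee2018, Thm. 12.4] -/
theorem diffeomorph_sphere_of_ricci_eq_three (h : gursky_einstein_homotopySphere_four)
    (M : Type) [TopologicalSpace M] [T2Space M] [SecondCountableTopology M]
    [ChartedSpace (EuclideanSpace ℝ (Fin 4)) M] [IsManifold (𝓡 4) ∞ M] [CompactSpace M]
    [MeasurableSpace M] [BorelSpace M] (e : M ≃ₕ Metric.sphere (0 : EuclideanSpace ℝ (Fin 5)) 1)
    (hm : Bundle.ContMDiffRiemannianMetric (𝓡 4) ∞ (EuclideanSpace ℝ (Fin 4))
      (TangentSpace (𝓡 4) : M → Type _)) [(PseudoRiemannianMetric.ofRiemannian hm).HasLeviCivita]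
    (hRic : ∀ (x : M) (v w : TangentSpace (𝓡 4) x),
      (PseudoRiemannianMetric.ofRiemannian hm).ricci x v w = 3 * hm.inner x v w)
    (hVol : ENNReal.ofReal (8 * Real.pi ^ 2 / 9) < riemannianMeasure hm Set.univ) :
    Nonempty (M ≃ₘ⟮𝓡 4, 𝓡 4⟯ Metric.sphere (0 : EuclideanSpace ℝ (Fin 5)) 1) := by
  haveI : T3Space M := inferInstance
  have hg : (PseudoRiemannianMetric.ofRiemannian hm).IsRiemannian :=
    isRiemannian_ofRiemannian hm
  rcases diffeomorph_sphere_or_volume_le_killingHopf M h e (PseudoRiemannianMetric.ofRiemannian hm)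
      hg (by norm_num : (0 : ℝ) < 3) hRic with hdiff | hvol
  · exact hdiff
  · exfalso
    have hround : (PseudoRiemannianMetric.ofRiemannian hm).toContMDiffRiemannianMetric hg = hm :=
      rfl
    have h9 : ENNReal.ofReal (8 * Real.pi ^ 2 / (3 : ℝ) ^ 2) =
        ENNReal.ofReal (8 * Real.pi ^ 2 / 9) := by norm_num
    rw [hround, h9] at hvol
    exact absurd (hVol.trans_le hvol) (lt_irrefl _)

/-- The same from the existential hypothesis of the crux ("`M ≃ₕ S⁴` carries an Einstein metric
`Ric = 3h` with `Vol > 8π²/9`"), i.e. literally the statement of the line's stub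
`stub_einsteinWeylGap`, conditional on `gursky_einstein_homotopySphere_four`.
[cite: Gursky2000, Thm. 1] [cite: Lee2018, Thm. 12.4] -/
theorem diffeomorph_sphere_of_exists_ricci_eq_three (h : gursky_einstein_homotopySphere_four)
    (M : Type) [TopologicalSpace M] [T2Space M] [SecondCountableTopology M]
    [ChartedSpace (EuclideanSpace ℝ (Fin 4)) M] [IsManifold (𝓡 4) ∞ M] [CompactSpace M]
    [MeasurableSpace M] [BorelSpace M] (e : M ≃ₕ Metric.sphere (0 : EuclideanSpace ℝ (Fin 5)) 1)
    (hex : ∃ hm : Bundle.ContMDiffRiemannianMetric (𝓡 4) ∞ (EuclideanSpace ℝ (Fin 4))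
        (TangentSpace (𝓡 4) : M → Type _),
      ∃ _ : (PseudoRiemannianMetric.ofRiemannian hm).HasLeviCivita,
        (∀ (x : M) (v w : TangentSpace (𝓡 4) x),
          (PseudoRiemannianMetric.ofRiemannian hm).ricci x v w = 3 * hm.inner x v w) ∧
        ENNReal.ofReal (8 * Real.pi ^ 2 / 9) < riemannianMeasure hm Set.univ) :
    Nonempty (M ≃ₘ⟮𝓡 4, 𝓡 4⟯ Metric.sphere (0 : EuclideanSpace ℝ (Fin 5)) 1) := by
  obtain ⟨hm, hLC, hRic, hVol⟩ := hex
  exact diffeomorph_sphere_of_ricci_eq_three h M e hm hRic hVol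

end gursky_einstein_homotopySphere_four

end Literature.Geometry.Riemannian

end
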